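import Summits.BirchSwinnertonDyer.BirchSwinnertonDyer.Theorems.Rank2Observatory2DescZ2Point
import Summits.BirchSwinnertonDyer.BirchSwinnertonDyer.Theorems.Rank2Observatory2DescZ2OddCase
import Summits.BirchSwinnertonDyer.BirchSwinnertonDyer.Theorems.Rank2Observatory2DescZ2TwoCase
import HarnessLib

/-!
# BirchSwinnertonDyer — rank ≥ 2 observatory: the row kit of the ℤ/2-torsion `2`-descent (generic soundness of the local clauses)

HONEST FRAMING: per-curve certified theorems and census instruments; no claim on BSD in rank ≥ 2.

Generic piece of the successor instrument KERNEL-2DESC-Z2 (spec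
`code/b2b-bsdr2-cert-3/kernel-2desc-z2/README-Z2.md`). Everything a per-row file needs between its
certificate tables and the hypothesis `hadm` of the cover theorem
`…Z2RankBound.mordellWeilRank_le_of_coverSet_z2`:

* linear algebra of `K = ℚ(θ)`, `θ² + Aθ + B = 0`, `A² − 4B` not a square: `theta_not_rat`,
  `linIndep_quad`, `span_quad` (hypotheses `hθQ`, `hlinK`, `hspanK` of the cover theorem);
* classes of products: `bitsAt_one`, `bitsAt_prod` (and `₂`): the class of
  `w(T, U) = ∏_{i∈T} uᵢ · ∏_{j∈U} Gⱼ` is the sum of the certified classes of the factors;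
* kernel certificates: `dvd_of_res_eq_zero` / `dvd_of_res_sq_ne_one` — for a PRIME element `π` with
  `res π = 0` (resp. `res π` even in `ℤ/8`), `res β = 0 ⇒ π ∣ β` (the field `hker` of `SplitPrime` /
  `SplitTwo`), because `(π)` is maximal in the Dedekind domain `𝓞 K`;
* **`oddClause_sound`**, **`twoClause_sound`**: given the split data at `ℓ` (resp. `2`), the residues
  of `θ`, the certified class tables of the units `uᵢ` and generators `Gⱼ`, and an explicit finite set
  `N` containing the three (resp. two) shapes of `…Z2OddCase.classes_point_cases`
  (resp. `…Z2TwoCase.classes_point_cases₂`) and the class of `−θ` (the torsion point `x = 0`), every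
  pair `(T, U)` realised by a rational point — `(x − θ)·w(T,U) ∈ K²` — has its table sum in `N`.
  Per row the four containments are `decide`s and the class tables are `bitsAt_eq` certificates.

Sorry-free; axioms `propext`, `Classical.choice`, `Quot.sound`.
[cite: Cassels1991LecturesEllipticCurves, §15] [cite: SilvermanAEC2009, Prop. X.1.4]
-/

-- single-conjunct summit: `Summit.BirchSwinnertonDyer.BirchSwinnertonDyer.…` repeats the name by design
set_option linter.dupNamespace false

noncomputable section

open scoped NumberField

namespace Summit.BirchSwinnertonDyer.BirchSwinnertonDyer.Rank2Observatory.TwoDescZ2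

/-! ## Linear algebra of a quadratic `θ` -/

section LinAlg

variable {K : Type*} [Field K] [CharZero K] [Algebra ℚ K]

/-- `θ² + Aθ + B = 0` with `A² − 4B` not a rational square ⇒ `θ ∉ ℚ`. [folklore] -/
theorem theta_not_rat {A B : ℤ} {θ : K}
    (hθ : θ ^ 2 + algebraMap ℚ K (A : ℚ) * θ + algebraMap ℚ K (B : ℚ) = 0)
    (hd : ¬ IsSquare (((A ^ 2 - 4 * B : ℤ)) : ℚ)) : ∀ q : ℚ, algebraMap ℚ K q ≠ θ := by
  intro q hq
  apply hd
  refine ⟨2 * q + A, ?_⟩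
  have h : algebraMap ℚ K (q ^ 2 + A * q + B) = 0 := by
    rw [← hq] at hθ
    simpa only [map_add, map_mul, map_pow, map_intCast] using hθ
  have h0 : q ^ 2 + A * q + B = 0 := (algebraMap ℚ K).injective (by rw [h, map_zero])
  push_cast
  linear_combination -4 * h0

/-- `1, θ` are `ℚ`-linearly independent. [folklore] -/
theorem linIndep_quad {θ : K} (hθQ : ∀ q : ℚ, algebraMap ℚ K q ≠ θ) :
    ∀ c₀ c₁ : ℚ, algebraMap ℚ K c₁ * θ + algebraMap ℚ K c₀ = 0 → c₀ = 0 ∧ c₁ = 0 := by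
  intro c₀ c₁ h
  by_cases hc₁ : c₁ = 0
  · rw [hc₁, map_zero, zero_mul, zero_add] at h
    exact ⟨(algebraMap ℚ K).injective (by rw [h, map_zero]), hc₁⟩
  · exfalso
    apply hθQ (-c₀ / c₁)
    have hc₁K : algebraMap ℚ K c₁ ≠ 0 := (map_ne_zero _).mpr hc₁
    rw [map_div₀, map_neg, div_eq_iff hc₁K]
    linear_combination -h

/-- `1, θ` span `K` when `[K : ℚ] = 2`. [folklore] -/
theorem span_quad [FiniteDimensional ℚ K] (h2 : Module.finrank ℚ K = 2) {θ : K}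
    (hθQ : ∀ q : ℚ, algebraMap ℚ K q ≠ θ) :
    ∀ z : K, ∃ c₀ c₁ : ℚ, z = algebraMap ℚ K c₁ * θ + algebraMap ℚ K c₀ := by
  have hli : LinearIndependent ℚ ![(1 : K), θ] := by
    rw [LinearIndependent.pair_iff]
    intro s t hst
    have h := linIndep_quad hθQ s t (by
      rw [Algebra.smul_def, Algebra.smul_def, mul_one] at hst
      linear_combination hst)
    exact ⟨h.1, h.2⟩
  have hsp := hli.span_eq_top_of_card_eq_finrank' (by rw [h2]; rfl)
  intro z
  have hz : z ∈ Submodule.span ℚ (Set.range ![(1 : K), θ]) := by rw [hsp]; exact Submodule.mem_top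
  obtain ⟨c, hc⟩ := (Submodule.mem_span_range_iff_exists_fun ℚ).mp hz
  refine ⟨c 0, c 1, ?_⟩
  rw [← hc, Fin.sum_univ_two]
  simp only [Matrix.cons_val_zero, Matrix.cons_val_one]
  rw [Algebra.smul_def, Algebra.smul_def, mul_one, add_comm]

/-- A non-square certificate over `ℚ` from one modulus. [folklore] -/
theorem not_isSquare_rat_of_zmod {d : ℤ} (p : ℕ) (h : ∀ t : ZMod p, t * t ≠ (d : ZMod p)) :
    ¬ IsSquare ((d : ℤ) : ℚ) := by
  rw [Rat.isSquare_intCast_iff]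
  rintro ⟨r, hr⟩
  exact h (r : ZMod p) (by rw [hr]; push_cast; ring)

end LinAlg

/-! ## Classes of products -/

section Products

variable {R : Type*} [CommRing R] [CharZero R] [IsDomain R] [WfDvdMonoid R]

/-- `bitsAt d 1 = 0`. [folklore] -/
theorem bitsAt_one {ℓ : ℕ} [Fact ℓ.Prime] (d : SplitPrime R ℓ) : bitsAt d 1 = 0 := by
  simpa using bitsAt_sq (d := d) (γ := 1) one_ne_zero

/-- `bitsAt` is additive over a `Finset` product of non-zero elements. [folklore] -/
theorem bitsAt_prod {ℓ : ℕ} [Fact ℓ.Prime] (d : SplitPrime R ℓ) {ι : Type*} (U : Finset ι)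
    {G : ι → R} (hG0 : ∀ j, G j ≠ 0) : bitsAt d (∏ j ∈ U, G j) = ∑ j ∈ U, bitsAt d (G j) := by
  induction U using Finset.cons_induction with
  | empty => rw [Finset.prod_empty, Finset.sum_empty, bitsAt_one]
  | cons a s ha ih =>
    rw [Finset.prod_cons, Finset.sum_cons, bitsAt_mul (hG0 a)
      (Finset.prod_ne_zero_iff.mpr fun j _ => hG0 j), ih]

/-- `bitsAt₂ d 1 = 0`. [folklore] -/
theorem bitsAt₂_one (d : SplitTwo R) : bitsAt₂ d 1 = 0 := by
  simpa using bitsAt₂_sq (d := d) (γ := 1) one_ne_zero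

/-- `bitsAt₂` is additive over a `Finset` product of non-zero elements. [folklore] -/
theorem bitsAt₂_prod (d : SplitTwo R) {ι : Type*} (U : Finset ι) {G : ι → R} (hG0 : ∀ j, G j ≠ 0) :
    bitsAt₂ d (∏ j ∈ U, G j) = ∑ j ∈ U, bitsAt₂ d (G j) := by
  induction U using Finset.cons_induction with
  | empty => rw [Finset.prod_empty, Finset.sum_empty, bitsAt₂_one]
  | cons a s ha ih =>
    rw [Finset.prod_cons, Finset.sum_cons, bitsAt₂_mul (hG0 a)
      (Finset.prod_ne_zero_iff.mpr fun j _ => hG0 j), ih]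

end Products

/-! ## Kernel certificates from a prime generator -/

section Kernel

variable {R : Type*} [CommRing R] [Ring.DimensionLEOne R]

/-- If `π` is a prime element in the kernel of `res : R → S` (`S` non-trivial, `R` of dimension ≤ 1),
then `ker res = (π)`. [folklore] -/
theorem ker_eq_span_of_prime {S : Type*} [CommRing S] [Nontrivial S] (res : R →+* S) {π : R}
    (hπ : Prime π) (h0 : res π = 0) : RingHom.ker res = Ideal.span {π} := by
  have hmax : (Ideal.span ({π} : Set R)).IsMaximal :=
    ((Ideal.span_singleton_prime hπ.ne_zero).mpr hπ).isMaximal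
      (by rw [Ne, Ideal.span_singleton_eq_bot]; exact hπ.ne_zero)
  refine (hmax.eq_of_le ?_ ?_).symm
  · intro htop
    have h1 : (1 : R) ∈ RingHom.ker res := by rw [htop]; exact Submodule.mem_top
    rw [RingHom.mem_ker, map_one] at h1
    exact one_ne_zero h1
  · rw [Ideal.span_le, Set.singleton_subset_iff]
    exact h0

/-- `hker` of `SplitPrime`. [folklore] -/
theorem dvd_of_res_eq_zero {S : Type*} [CommRing S] [Nontrivial S] (res : R →+* S) {π : R}
    (hπ : Prime π) (h0 : res π = 0) : ∀ β : R, res β = 0 → π ∣ β := by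
  intro β hβ
  have h : β ∈ RingHom.ker res := hβ
  rw [ker_eq_span_of_prime res hπ h0] at h
  exact Ideal.mem_span_singleton.mp h

/-- `x² ≠ 1` in `ZMod 8` iff `x` is even, i.e. its image in `ZMod 2` is `0` (by `decide`). [folklore] -/
theorem zmod8_sq_ne_one_iff_cast : ∀ x : ZMod 8, x ^ 2 ≠ 1 ↔ (ZMod.castHom (show 2 ∣ 8 by norm_num) (ZMod 2) x = 0) := by
  decide

/-- `hker` of `SplitTwo`: `π` prime with `res π` even ⇒ every `β` with `res β` even is divisible by
`π`. [folklore] -/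
theorem dvd_of_res_sq_ne_one (res : R →+* ZMod 8) {π : R} (hπ : Prime π) (h0 : res π ^ 2 ≠ 1) :
    ∀ β : R, res β ^ 2 ≠ 1 → π ∣ β := by
  set res₂ : R →+* ZMod 2 := (ZMod.castHom (show 2 ∣ 8 by norm_num) (ZMod 2)).comp res with hres₂
  have h0' : res₂ π = 0 := (zmod8_sq_ne_one_iff_cast _).mp h0
  intro β hβ
  exact dvd_of_res_eq_zero res₂ hπ h0' β ((zmod8_sq_ne_one_iff_cast _).mp hβ)

end Kernel

/-! ## Soundness of the local clauses -/

section Sound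

variable {K : Type*} [Field K] [NumberField K]

/-- `n − eθ ≠ 0` for `e ≠ 0` when `θ ∉ ℚ`. [folklore] -/
theorem sub_ne_zero_of_not_rat {θ : 𝓞 K}
    (hθQ : ∀ q : ℚ, algebraMap ℚ K q ≠ algebraMap (𝓞 K) K θ) {n e : ℤ} (he : e ≠ 0) :
    (n : 𝓞 K) - (e : 𝓞 K) * θ ≠ 0 := by
  intro h
  apply hθQ ((n : ℚ) / e)
  have h' := congrArg (algebraMap (𝓞 K) K) h
  rw [map_sub, map_mul, map_intCast, map_intCast, map_zero, sub_eq_zero] at h'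
  have heK : (e : K) ≠ 0 := by exact_mod_cast he
  rw [map_div₀, map_intCast, map_intCast, div_eq_iff heK, h', mul_comm]

/-- The class of a product of units and generators is the sum of the certified classes (odd). -/
theorem bitsAt_w_eq {ℓ : ℕ} [Fact ℓ.Prime] (d : SplitPrime (𝓞 K) ℓ) {m s : ℕ} {Wu : Fin m → (𝓞 K)ˣ}
    {G : Fin s → 𝓞 K} (hG0 : ∀ j, G j ≠ 0) {bu : Fin m → ZMod 2 × ZMod 2} {bg : Fin s → ZMod 2 × ZMod 2}
    (hbu : ∀ i, bitsAt d (Wu i : 𝓞 K) = bu i) (hbg : ∀ j, bitsAt d (G j) = bg j)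
    (T : Finset (Fin m)) (U : Finset (Fin s)) :
    bitsAt d ((∏ i ∈ T, (Wu i : 𝓞 K)) * ∏ j ∈ U, G j) = ∑ i ∈ T, bu i + ∑ j ∈ U, bg j := by
  have hWu0 : ∀ i, ((Wu i : 𝓞 K)) ≠ 0 := fun i => (Wu i).ne_zero
  rw [bitsAt_mul (Finset.prod_ne_zero_iff.mpr fun i _ => hWu0 i)
    (Finset.prod_ne_zero_iff.mpr fun j _ => hG0 j), bitsAt_prod d T hWu0, bitsAt_prod d U hG0,
    Finset.sum_congr rfl (fun i _ => hbu i), Finset.sum_congr rfl (fun j _ => hbg j)]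

/-- The class of a product of units and generators is the sum of the certified classes (at `2`). -/
theorem bitsAt₂_w_eq (d : SplitTwo (𝓞 K)) {m s : ℕ} {Wu : Fin m → (𝓞 K)ˣ}
    {G : Fin s → 𝓞 K} (hG0 : ∀ j, G j ≠ 0) {bu : Fin m → ZMod 2 × ZMod 2 × ZMod 2}
    {bg : Fin s → ZMod 2 × ZMod 2 × ZMod 2}
    (hbu : ∀ i, bitsAt₂ d (Wu i : 𝓞 K) = bu i) (hbg : ∀ j, bitsAt₂ d (G j) = bg j)
    (T : Finset (Fin m)) (U : Finset (Fin s)) :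
    bitsAt₂ d ((∏ i ∈ T, (Wu i : 𝓞 K)) * ∏ j ∈ U, G j) = ∑ i ∈ T, bu i + ∑ j ∈ U, bg j := by
  have hWu0 : ∀ i, ((Wu i : 𝓞 K)) ≠ 0 := fun i => (Wu i).ne_zero
  rw [bitsAt₂_mul (Finset.prod_ne_zero_iff.mpr fun i _ => hWu0 i)
    (Finset.prod_ne_zero_iff.mpr fun j _ => hG0 j), bitsAt₂_prod d T hWu0, bitsAt₂_prod d U hG0,
    Finset.sum_congr rfl (fun i _ => hbu i), Finset.sum_congr rfl (fun j _ => hbg j)]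

/-- **Soundness of the odd-prime clause.** [cite: Cassels1991LecturesEllipticCurves, §15] -/
theorem oddClause_sound {ℓ : ℕ} [Fact ℓ.Prime] (d₁ d₂ : SplitPrime (𝓞 K) ℓ) {A B : ℤ} {θ : 𝓞 K}
    (hq : θ ^ 2 + (A : 𝓞 K) * θ + (B : 𝓞 K) = 0) (hθ0 : θ ≠ 0)
    (hθQ : ∀ q : ℚ, algebraMap ℚ K q ≠ algebraMap (𝓞 K) K θ)
    {t₁ t₂ : ZMod ℓ} (ht₁ : d₁.res θ = t₁) (ht₂ : d₂.res θ = t₂)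
    (hs₁ : (A : ZMod ℓ) + 2 * t₁ ≠ 0) (hs₂ : (A : ZMod ℓ) + 2 * t₂ ≠ 0)
    {c₁ c₂ : ZMod 2} (hc₁ : qrOf (d₁.res d₁.π') = c₁) (hc₂ : qrOf (d₂.res d₂.π') = c₂)
    {m s : ℕ} {Wu : Fin m → (𝓞 K)ˣ} {G : Fin s → 𝓞 K} (hG0 : ∀ j, G j ≠ 0)
    {bu₁ bu₂ : Fin m → ZMod 2 × ZMod 2} {bg₁ bg₂ : Fin s → ZMod 2 × ZMod 2}
    (hbu₁ : ∀ i, bitsAt d₁ (Wu i : 𝓞 K) = bu₁ i) (hbu₂ : ∀ i, bitsAt d₂ (Wu i : 𝓞 K) = bu₂ i)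
    (hbg₁ : ∀ j, bitsAt d₁ (G j) = bg₁ j) (hbg₂ : ∀ j, bitsAt d₂ (G j) = bg₂ j)
    (N : Finset ((ZMod 2 × ZMod 2) × (ZMod 2 × ZMod 2)))
    (hNA : ∀ r s : ZMod ℓ, r ≠ 0 → s ≠ 0 → (clsA A t₁ r s, clsA A t₂ r s) ∈ N)
    (hNB : ∀ r : ZMod ℓ, r ≠ 0 → (((0 : ZMod 2), sqb r), ((0 : ZMod 2), sqb r)) ∈ N)
    (hNC : ∀ (vb : ZMod 2) (r s : ZMod ℓ), r ≠ 0 → s ≠ 0 →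
      (clsC A t₁ c₁ vb r s, clsC A t₂ c₂ vb r s) ∈ N)
    (hN0 : (bitsAt d₁ (-θ), bitsAt d₂ (-θ)) ∈ N)
    {x y : ℚ} (hE : y ^ 2 = x ^ 3 + A * x ^ 2 + B * x) (T : Finset (Fin m)) (U : Finset (Fin s))
    (hsq : IsSquare ((algebraMap ℚ K x - algebraMap (𝓞 K) K θ) *
      (∏ i ∈ T, algebraMap (𝓞 K) K (Wu i : 𝓞 K)) * ∏ j ∈ U, algebraMap (𝓞 K) K (G j))) :
    (∑ i ∈ T, bu₁ i + ∑ j ∈ U, bg₁ j, ∑ i ∈ T, bu₂ i + ∑ j ∈ U, bg₂ j) ∈ N := by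
  set wTU : 𝓞 K := (∏ i ∈ T, (Wu i : 𝓞 K)) * ∏ j ∈ U, G j with hw
  have hw0 : wTU ≠ 0 := mul_ne_zero (Finset.prod_ne_zero_iff.mpr fun i _ => (Wu i).ne_zero)
    (Finset.prod_ne_zero_iff.mpr fun j _ => hG0 j)
  have hsq' : IsSquare ((algebraMap ℚ K x - algebraMap (𝓞 K) K θ) * algebraMap (𝓞 K) K wTU) := by
    rw [hw, map_mul, map_prod, map_prod, ← mul_assoc]; exact hsq
  obtain ⟨n, d₀, mm, hd₀, hcop, hx, hEZ⟩ := exists_integral_form hE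
  have hx' : x = (n : ℚ) / ((d₀ ^ 2 : ℤ) : ℚ) := by rw [hx, Int.cast_pow]
  have hα : (n : 𝓞 K) - ((d₀ ^ 2 : ℤ) : 𝓞 K) * θ ≠ 0 := sub_ne_zero_of_not_rat hθQ (pow_ne_zero 2 hd₀)
  have hT₁ := bitsAt_point_eq_of_isSquare d₁ (rfl : (d₀ ^ 2 : ℤ) = d₀ ^ 2) hd₀ hx' hα hw0 hsq'
  have hT₂ := bitsAt_point_eq_of_isSquare d₂ (rfl : (d₀ ^ 2 : ℤ) = d₀ ^ 2) hd₀ hx' hα hw0 hsq'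
  rw [← bitsAt_w_eq d₁ hG0 hbu₁ hbg₁ T U, ← bitsAt_w_eq d₂ hG0 hbu₂ hbg₂ T U, ← hT₁, ← hT₂]
  by_cases hn : n = 0
  · -- the torsion point `x = 0`: the class of `−θ`
    have hd₀R : ((d₀ : 𝓞 K)) ≠ 0 := by exact_mod_cast hd₀
    have hneg : (n : 𝓞 K) - ((d₀ ^ 2 : ℤ) : 𝓞 K) * θ = (-θ) * (d₀ : 𝓞 K) ^ 2 := by
      rw [hn]; push_cast; ring
    rw [hneg, bitsAt_mul (neg_ne_zero.mpr hθ0) (pow_ne_zero 2 hd₀R),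
      bitsAt_mul (neg_ne_zero.mpr hθ0) (pow_ne_zero 2 hd₀R), bitsAt_sq hd₀R, bitsAt_sq hd₀R,
      add_zero, add_zero]
    exact hN0
  · have hℓ : ¬ IsUnit (ℓ : ℤ) := (Nat.prime_iff_prime_int.mp Fact.out).not_unit
    rcases classes_point_cases hq ht₁ ht₂ hs₁ hs₂ hc₁ hc₂ hn rfl
        (not_dvd_and_dvd_of_isCoprime hcop hℓ) hEZ hα with
      ⟨r, s', hr, hs, hpair⟩ | ⟨r, hr, hpair⟩ | ⟨v, r, s', -, hr, hs, hpair⟩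
    · rw [hpair]; exact hNA r s' hr hs
    · rw [hpair]; exact hNB r hr
    · rw [hpair]; exact hNC _ r s' hr hs

/-- **Soundness of the `2`-adic clause** (`A` odd). [cite: Cassels1991LecturesEllipticCurves, §15] -/
theorem twoClause_sound (d₁ d₂ : SplitTwo (𝓞 K)) {A B : ℤ} {θ : 𝓞 K}
    (hq : θ ^ 2 + (A : 𝓞 K) * θ + (B : 𝓞 K) = 0) (hθ0 : θ ≠ 0)
    (hθQ : ∀ q : ℚ, algebraMap ℚ K q ≠ algebraMap (𝓞 K) K θ) (hA : ((A : ZMod 8)) ^ 2 = 1)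
    {t₁ t₂ : ZMod 8} (ht₁ : d₁.res θ = t₁) (ht₂ : d₂.res θ = t₂)
    {ρ₁ ρ₂ : ZMod 8} (hρ₁ : d₁.res d₁.π' = ρ₁) (hρ₂ : d₂.res d₂.π' = ρ₂)
    {m s : ℕ} {Wu : Fin m → (𝓞 K)ˣ} {G : Fin s → 𝓞 K} (hG0 : ∀ j, G j ≠ 0)
    {bu₁ bu₂ : Fin m → ZMod 2 × ZMod 2 × ZMod 2} {bg₁ bg₂ : Fin s → ZMod 2 × ZMod 2 × ZMod 2}
    (hbu₁ : ∀ i, bitsAt₂ d₁ (Wu i : 𝓞 K) = bu₁ i) (hbu₂ : ∀ i, bitsAt₂ d₂ (Wu i : 𝓞 K) = bu₂ i)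
    (hbg₁ : ∀ j, bitsAt₂ d₁ (G j) = bg₁ j) (hbg₂ : ∀ j, bitsAt₂ d₂ (G j) = bg₂ j)
    (N : Finset ((ZMod 2 × ZMod 2 × ZMod 2) × (ZMod 2 × ZMod 2 × ZMod 2)))
    (hN1 : ∀ (vb : ZMod 2) (w r : ZMod 8), wcond vb w = true → r ^ 2 = 1 →
      (cls₂ A t₁ ρ₁ vb w r, cls₂ A t₂ ρ₂ vb w r) ∈ N)
    (hN2 : ∀ r e₈ : ZMod 8, r ^ 2 = 1 → (e₈ = 0 ∨ e₈ = 4) →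
      (((0 : ZMod 2), bits8 (r - e₈ * t₁)), ((0 : ZMod 2), bits8 (r - e₈ * t₂))) ∈ N)
    (hN0 : (bitsAt₂ d₁ (-θ), bitsAt₂ d₂ (-θ)) ∈ N)
    {x y : ℚ} (hE : y ^ 2 = x ^ 3 + A * x ^ 2 + B * x) (T : Finset (Fin m)) (U : Finset (Fin s))
    (hsq : IsSquare ((algebraMap ℚ K x - algebraMap (𝓞 K) K θ) *
      (∏ i ∈ T, algebraMap (𝓞 K) K (Wu i : 𝓞 K)) * ∏ j ∈ U, algebraMap (𝓞 K) K (G j))) :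
    (∑ i ∈ T, bu₁ i + ∑ j ∈ U, bg₁ j, ∑ i ∈ T, bu₂ i + ∑ j ∈ U, bg₂ j) ∈ N := by
  set wTU : 𝓞 K := (∏ i ∈ T, (Wu i : 𝓞 K)) * ∏ j ∈ U, G j with hw
  have hw0 : wTU ≠ 0 := mul_ne_zero (Finset.prod_ne_zero_iff.mpr fun i _ => (Wu i).ne_zero)
    (Finset.prod_ne_zero_iff.mpr fun j _ => hG0 j)
  have hsq' : IsSquare ((algebraMap ℚ K x - algebraMap (𝓞 K) K θ) * algebraMap (𝓞 K) K wTU) := by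
    rw [hw, map_mul, map_prod, map_prod, ← mul_assoc]; exact hsq
  obtain ⟨n, d₀, mm, hd₀, hcop, hx, hEZ⟩ := exists_integral_form hE
  have hx' : x = (n : ℚ) / ((d₀ ^ 2 : ℤ) : ℚ) := by rw [hx, Int.cast_pow]
  have hα : (n : 𝓞 K) - ((d₀ ^ 2 : ℤ) : 𝓞 K) * θ ≠ 0 := sub_ne_zero_of_not_rat hθQ (pow_ne_zero 2 hd₀)
  have hT₁ := bitsAt₂_point_eq_of_isSquare d₁ (rfl : (d₀ ^ 2 : ℤ) = d₀ ^ 2) hd₀ hx' hα hw0 hsq'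
  have hT₂ := bitsAt₂_point_eq_of_isSquare d₂ (rfl : (d₀ ^ 2 : ℤ) = d₀ ^ 2) hd₀ hx' hα hw0 hsq'
  rw [← bitsAt₂_w_eq d₁ hG0 hbu₁ hbg₁ T U, ← bitsAt₂_w_eq d₂ hG0 hbu₂ hbg₂ T U, ← hT₁, ← hT₂]
  by_cases hn : n = 0
  · have hd₀R : ((d₀ : 𝓞 K)) ≠ 0 := by exact_mod_cast hd₀
    have hneg : (n : 𝓞 K) - ((d₀ ^ 2 : ℤ) : 𝓞 K) * θ = (-θ) * (d₀ : 𝓞 K) ^ 2 := by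
      rw [hn]; push_cast; ring
    rw [hneg, bitsAt₂_mul (neg_ne_zero.mpr hθ0) (pow_ne_zero 2 hd₀R),
      bitsAt₂_mul (neg_ne_zero.mpr hθ0) (pow_ne_zero 2 hd₀R), bitsAt₂_sq hd₀R, bitsAt₂_sq hd₀R,
      add_zero, add_zero]
    exact hN0
  · rcases classes_point_cases₂ hq ht₁ ht₂ hA hρ₁ hρ₂ hn rfl
        (not_dvd_and_dvd_of_isCoprime hcop Int.prime_two.not_unit) hEZ hα with
      ⟨vb, w, r, hwc, hr, hpair⟩ | ⟨r, e₈, hr, he₈, hpair⟩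
    · rw [hpair]; exact hN1 vb w r hwc hr
    · rw [hpair]; exact hN2 r e₈ hr he₈

end Sound

end Summit.BirchSwinnertonDyer.BirchSwinnertonDyer.Rank2Observatory.TwoDescZ2

end
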